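import Summits.AtomisticToContinuum.FouriersLaw.Theorems.OddSectorIrreversibilityTapLeakBoundLocalMomentQ

/-!
# `TapLeakBound` (stmt-AtomisticToContinuum-15159), line `SketchIdeator2`: the position tap budget from stubs M ∧ D

Helper file (`--supports stmt-AtomisticToContinuum-15159`) for crux P =
`Summit.AtomisticToContinuum.FouriersLaw.Theses.OddSectorIrreversibility.TapLeakBound` (route
`OddSectorIrreversibility`, sub-problem `FouriersLaw`). By-product of the stub-worker on the registered stub D
`stub_hessianDrive` (NOT proved here); part 2 of 2 (part 1 = `…TapLeakBoundPositionTapGlue.lean` (p140030): the `N`-uniform position tap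
budget `‖∂_{q_b}u‖² ≤ C(|⟨u,J⟩| + Z)` already implies `MixedTapBound` by Cauchy–Schwarz + the tap identity).

**Conversely, stubs M (`stub_partialQMem`, fixed-`N` membership `∂_{q_b}u ∈ L²(μ_T)`) and D (`stub_hessianDrive`, the
`N`-uniform Hessian-drive budget `‖G_b‖² ≤ C(|⟨u,J⟩| + Z)`, `G_b = Σ_i (∂_{q_b}∂_{q_i}H) ∂_{p_i}u`) give the position tap
budget** over the landed overdamped calculus (`generator_overdamped_of_poisson`, `resolvent_contraction`,
…TapLeakBoundOverdamped): `∂_{q_b}u = κ(∂_{p_b}u − w)`, `κ = γB_b ∈ [γ, 2γ]`, `w` the overdamped derivative with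
`κ²‖w‖² ≤ ‖F‖² ≤ 3(‖∂_{p_b}J‖² + κ⁻²(‖∂_{q_b}J‖² + ‖G_b‖²))` and `κT‖∂_{p_b}u‖² ≤ ⟨u,J⟩`, whence
`‖∂_{q_b}u‖² ≤ (4γ/T)⟨u,J⟩ + 6‖∂_{p_b}J‖² + 6γ⁻²(‖∂_{q_b}J‖² + ‖G_b‖²)` (`positionTap_of_hessianDrive_core`); the landed local
moments `stub_localMoment`, `stub_localMomentQ` finish (`positionTapBudget_of_membership_of_hessianDrive`,
`C = 4γ/T + 6(C_J⁺ + (C_Q⁺ + C_G⁺)/γ²)`). So the position tap budget is sandwiched between (M ∧ D) and their only consumer: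
it is the exact first-order corrector-side residual of the line. References: folklore. Nothing here closes the item.
-/

noncomputable section

open MeasureTheory ProbabilityTheory Filter Topology Set Function
open scoped NNReal ENNReal ContDiff

namespace Summit.AtomisticToContinuum.FouriersLaw.Theorems.OddSectorIrreversibility.TapLeak

open Literature.MathematicalPhysics.KineticTheory.HeatConduction
open Literature.MathematicalPhysics.KineticTheory
open Summit.AtomisticToContinuum.FouriersLaw.Theorems.OddSectorWitness
open Summit.AtomisticToContinuum.FouriersLaw.Theorems.OddSectorIrreversibility.Corrector
open Summit.AtomisticToContinuum.FouriersLaw.Theorems.SuperadditiveResistance.DeviceLiouville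

/-! ### Fixed-`N` core -/

/-- The bath multiplicity is at most `2` (it is `2` only for the single site of the `N = 1` chain). [folklore] -/
theorem bathWeight_le_two {N : ℕ} (i : Fin N) : OscillatorChain.bathWeight N i ≤ 2 := by
  unfold OscillatorChain.bathWeight
  split_ifs <;> norm_num

section Core

variable {ω₂ lam β γ : ℝ} (hω : 0 < ω₂) (hl : 0 ≤ lam) (hβ : 0 ≤ β) (hγ : 0 < γ) {T : ℝ} (hT : 0 < T)
  {N : ℕ}

include hω hl hβ hγ hT

/-- **The position tap norm from the Hessian drive, at fixed `N`.** For a smooth classical solution `u` of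
`L_{T,T} u = −J` at a contact `b` with `u, ∂_{q_b}u, ∂_{q_b}J, G ∈ L²(μ_T)`, `G = Σ_i (∂_{q_b}∂_{q_i}H) ∂_{p_i}u`:
`‖∂_{q_b}u‖² ≤ (4γ/T)⟨u,J⟩ + 6(‖∂_{p_b}J‖² + γ⁻²(‖∂_{q_b}J‖² + ‖G‖²))` (`∂_{q_b}u = κ(∂_{p_b}u − w)`, `κ = γB_b ≤ 2γ`,
`w` the overdamped derivative, `κ²‖w‖² ≤ ‖F‖²` by `resolvent_contraction`, `κT‖∂_{p_b}u‖² ≤ ⟨u,J⟩`). [folklore] -/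
theorem positionTap_of_hessianDrive_core (b : Fin N) (hb : b.val = 0 ∨ b.val = N - 1) {u : PhaseSpace N → ℝ}
    (hu : ContDiff ℝ ∞ u)
    (hpde : ∀ x, (pinnedChain ω₂ lam β γ).generator N T T u x =
      -(∑ k : Fin N, (pinnedChain ω₂ lam β γ).bondCurrent N k x))
    (hu2 : MemLp u 2 (gibbsWeight ω₂ lam β γ N T))
    (hqu2 : MemLp (partialQ b u) 2 (gibbsWeight ω₂ lam β γ N T))
    (hqJ2 : MemLp (partialQ b (fun z : PhaseSpace N => ∑ k : Fin N, (pinnedChain ω₂ lam β γ).bondCurrent N k z)) 2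
      (gibbsWeight ω₂ lam β γ N T))
    (hG2 : MemLp (fun x : PhaseSpace N => ∑ i : Fin N,
      partialQ b (partialQ i ((pinnedChain ω₂ lam β γ).hamiltonian N)) x * partialP i u x) 2
      (gibbsWeight ω₂ lam β γ N T)) :
    ∫ x, (partialQ b u x) ^ 2 ∂(gibbsWeight ω₂ lam β γ N T) ≤
      4 * γ / T * ∫ x, u x * (∑ k : Fin N, (pinnedChain ω₂ lam β γ).bondCurrent N k x) ∂(gibbsWeight ω₂ lam β γ N T) +
        6 * ((∫ x, (partialP b (fun z : PhaseSpace N => ∑ k : Fin N, (pinnedChain ω₂ lam β γ).bondCurrent N k z) x) ^ 2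
              ∂(gibbsWeight ω₂ lam β γ N T)) +
            ((∫ x, (partialQ b (fun z : PhaseSpace N => ∑ k : Fin N, (pinnedChain ω₂ lam β γ).bondCurrent N k z) x) ^ 2
                ∂(gibbsWeight ω₂ lam β γ N T)) +
              ∫ x, (∑ i : Fin N, partialQ b (partialQ i ((pinnedChain ω₂ lam β γ).hamiltonian N)) x *
                partialP i u x) ^ 2 ∂(gibbsWeight ω₂ lam β γ N T)) / γ ^ 2) := by
  -- adapted from `mixedTap_core` (…TapLeakBoundMixedTap)
  set P := pinnedChain ω₂ lam β γ with hP
  set μ := gibbsWeight ω₂ lam β γ N T with hμ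
  set B : ℝ := OscillatorChain.bathWeight N b with hB
  set J : PhaseSpace N → ℝ := fun z => ∑ k : Fin N, P.bondCurrent N k z with hJ
  set G : PhaseSpace N → ℝ := fun x => ∑ i : Fin N, partialQ b (partialQ i (P.hamiltonian N)) x * partialP i u x
    with hG
  set v : PhaseSpace N → ℝ := partialP b u with hv
  haveI : IsFiniteMeasure μ := isFiniteMeasure_gibbsWeight hω hl hβ γ N hT
  -- the contact carries a bath: `1 ≤ B ≤ 2`, `κ = γ B`, `c = κ⁻¹`
  have hB1 : 1 ≤ B := by
    simp only [hB]
    unfold OscillatorChain.bathWeight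
    rcases hb with h | h
    · rw [if_pos h]; split_ifs <;> norm_num
    · rw [if_pos h]; split_ifs <;> norm_num
  have hB2 : B ≤ 2 := bathWeight_le_two b
  have hB0 : 0 < B := lt_of_lt_of_le one_pos hB1
  set κ : ℝ := γ * B with hκ
  have hκ0 : 0 < κ := mul_pos hγ hB0
  have hγκ : γ ≤ κ := le_mul_of_one_le_right hγ.le hB1
  have hκ2 : κ ≤ 2 * γ := by
    have := mul_le_mul_of_nonneg_left hB2 hγ.le
    simp only [hκ]; linarith
  set c : ℝ := κ⁻¹ with hc
  have hcκ : c * κ = 1 := inv_mul_cancel₀ hκ0.ne'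
  have hc0 : 0 < c := inv_pos.2 hκ0
  -- smoothness
  have hu3 : ContDiff ℝ 3 u := hu.of_le (by norm_cast)
  have hu2c : ContDiff ℝ 2 u := hu.of_le (by norm_cast)
  have hJs : ContDiff ℝ ∞ J := contDiff_totalBondCurrent ω₂ lam β γ N
  have hJc : Continuous J := continuous_totalBondCurrent ω₂ lam β γ N
  have hU3 : ContDiff ℝ 3 P.U := pinnedChain_contDiff_U ω₂ lam β γ
  have hV3 : ContDiff ℝ 3 P.V := pinnedChain_contDiff_V ω₂ lam β γ
  have hH3 : ContDiff ℝ 3 (P.hamiltonian N) := P.contDiff_hamiltonian hU3 hV3 N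
  have hGc : Continuous G := by
    refine continuous_finsetSum _ fun i _ => Continuous.mul ?_ (continuous_partialP hu (by simp) i)
    exact continuous_partialQ (HeatConduction.contDiff_partialQ hH3 (m := 2) (by norm_num) i) two_ne_zero b
  -- the overdamped derivative `w` and its source `F`
  set w : PhaseSpace N → ℝ := fun y => v y - c * partialQ b u y with hw
  set F : PhaseSpace N → ℝ := fun x => partialP b J x - c * partialQ b J x + c * G x with hF
  have hw2c : ContDiff ℝ 2 w :=
    (contDiff_partialP hu3 (m := 2) (by norm_num) b).sub
      (contDiff_const.mul (HeatConduction.contDiff_partialQ hu3 (m := 2) (by norm_num) b))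
  have hFc : Continuous F :=
    ((continuous_partialP hJs (by simp) b).sub (continuous_const.mul (continuous_partialQ hJs (by simp) b))).add
      (continuous_const.mul hGc)
  have hpdew : ∀ x, P.generator N T T w x = -(F x - κ * w x) := by
    intro x
    have hcB : c * (P.γ * OscillatorChain.bathWeight N b) = 1 := hcκ
    have h := generator_overdamped_of_poisson P hU3 hV3 hu3 T b hcB hpde x
    have hPγ : P.γ = γ := rfl
    simp only [hw, hv, hF, hG, hJ, hκ, hB]
    rw [h, hPγ]
  -- `L²` bookkeeping
  have hϑ : 0 < 1 / (4 * T) := by positivity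
  have h2ϑ : 2 * (1 / (4 * T)) < 1 / T := by
    rw [show 2 * (1 / (4 * T)) = 1 / (2 * T) by field_simp; ring, div_lt_div_iff₀ (by positivity) hT]
    nlinarith
  obtain ⟨M, -, hJM⟩ := abs_totalBondCurrent_le_exp hω.le hl hβ γ N hϑ
  have hJ2π : MemLp J 2 (P.gibbsMeasure N T) := memLp_two_of_abs_le_exp hω hl hβ hT γ hJc h2ϑ hJM
  have hu2π : MemLp u 2 (P.gibbsMeasure N T) := memLp_gibbsMeasure_of_gibbsWeight hω hl hβ γ N hT hu2
  have hv2π : MemLp v 2 (P.gibbsMeasure N T) := memLp_partialP_of_poisson hω hl hβ hγ hT hu2c hu2π hJ2π hpde hB0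
  have hv2 : MemLp v 2 μ := memLp_gibbsWeight_of_gibbsMeasure hω hl hβ γ N hT hv2π
  have hw2 : MemLp w 2 μ := hv2.sub (hqu2.const_mul c)
  obtain ⟨CJ, hCJ⟩ := stub_localMoment ω₂ lam β γ hω hl hβ T hT
  have hdJ2 : MemLp (partialP b J) 2 μ := (hCJ N b hb).1
  have hF2 : MemLp F 2 μ := (hdJ2.sub (hqJ2.const_mul c)).add (hG2.const_mul c)
  -- (1) resolvent contraction: `κ² ‖w‖² ≤ ‖F‖²`
  have hRC := (resolvent_contraction hω hl hβ hγ hT hκ0 hw2c hw2 hFc hF2 hpdew).2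
  -- (2) the tap identity: `κ T ‖v‖² ≤ ⟨u, J⟩`
  have hρ : ∀ f : PhaseSpace N → ℝ, ∫ x, f x ∂μ = ∫ x, f x * P.gibbsDensity N T x := fun f =>
    gaussIBP_integral_gibbsWeight ω₂ lam β γ N T f
  have hD0 := integral_mul_source_eq_dirichlet hω hl hβ hγ hT hu2c hu2π hJc hJ2π hpde
  have hD0' : ∫ x, u x * J x ∂μ = γ * T * ∑ i, OscillatorChain.bathWeight N i * ∫ x, partialP i u x ^ 2 ∂μ := by
    rw [hρ]
    simp only [hρ]
    exact hD0
  have hIn : ∀ i, 0 ≤ ∫ x, partialP i u x ^ 2 ∂μ := fun i => integral_nonneg fun x => sq_nonneg _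
  have hle : B * ∫ x, (v x) ^ 2 ∂μ ≤ ∑ i, OscillatorChain.bathWeight N i * ∫ x, partialP i u x ^ 2 ∂μ :=
    Finset.single_le_sum (f := fun i => OscillatorChain.bathWeight N i * ∫ x, partialP i u x ^ 2 ∂μ)
      (fun i _ => mul_nonneg (Corrector.bathWeight_nonneg N i) (hIn i)) (Finset.mem_univ b)
  have htap : κ * T * ∫ x, (v x) ^ 2 ∂μ ≤ ∫ x, u x * J x ∂μ := by
    rw [hD0']
    have := mul_le_mul_of_nonneg_left hle (mul_nonneg hγ.le hT.le)
    calc κ * T * ∫ x, (v x) ^ 2 ∂μ = γ * T * (B * ∫ x, (v x) ^ 2 ∂μ) := by simp only [hκ]; ring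
      _ ≤ _ := this
  -- (3) `∂_{q_b}u = κ (v − w)` pointwise, so `‖∂_{q_b}u‖² ≤ 2κ²(‖v‖² + ‖w‖²)`
  have hIvv : Integrable (fun x => (v x) ^ 2) μ := hv2.integrable_sq
  have hIww : Integrable (fun x => (w x) ^ 2) μ := hw2.integrable_sq
  have hIqq : Integrable (fun x => (partialQ b u x) ^ 2) μ := hqu2.integrable_sq
  have hsplit : ∫ x, (partialQ b u x) ^ 2 ∂μ ≤ 2 * κ ^ 2 * ∫ x, (v x) ^ 2 ∂μ + 2 * κ ^ 2 * ∫ x, (w x) ^ 2 ∂μ := by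
    have hIs : Integrable (fun x => 2 * κ ^ 2 * (v x) ^ 2 + 2 * κ ^ 2 * (w x) ^ 2) μ :=
      (hIvv.const_mul _).add (hIww.const_mul _)
    have h : ∫ x, (partialQ b u x) ^ 2 ∂μ ≤ ∫ x, (2 * κ ^ 2 * (v x) ^ 2 + 2 * κ ^ 2 * (w x) ^ 2) ∂μ :=
      integral_mono hIqq hIs fun x => by
        show (partialQ b u x) ^ 2 ≤ 2 * κ ^ 2 * (v x) ^ 2 + 2 * κ ^ 2 * (w x) ^ 2
        have e : partialQ b u x = κ * (v x - w x) := by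
          simp only [hw]
          have : κ * (c * partialQ b u x) = partialQ b u x := by rw [← mul_assoc, mul_comm κ c, hcκ, one_mul]
          linarith [this]
        rw [e]
        nlinarith [sq_nonneg (v x + w x), sq_nonneg κ]
    rw [integral_add (hIvv.const_mul _) (hIww.const_mul _), integral_const_mul, integral_const_mul] at h
    exact h
  -- (4) `‖F‖² ≤ 3 (‖∂_{p_b}J‖² + c² ‖∂_{q_b}J‖² + c² ‖G‖²)`
  have hIFF : Integrable (fun x => (F x) ^ 2) μ := hF2.integrable_sq
  have hIpJ : Integrable (fun x => (partialP b J x) ^ 2) μ := hdJ2.integrable_sq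
  have hIqJ : Integrable (fun x => (partialQ b J x) ^ 2) μ := hqJ2.integrable_sq
  have hIGG : Integrable (fun x => (G x) ^ 2) μ := hG2.integrable_sq
  have hFle : ∫ x, (F x) ^ 2 ∂μ ≤
      3 * ((∫ x, (partialP b J x) ^ 2 ∂μ) + c ^ 2 * ∫ x, (partialQ b J x) ^ 2 ∂μ + c ^ 2 * ∫ x, (G x) ^ 2 ∂μ) := by
    have hI12 : Integrable (fun x => (partialP b J x) ^ 2 + c ^ 2 * (partialQ b J x) ^ 2) μ :=
      hIpJ.add (hIqJ.const_mul (c ^ 2))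
    have hI3 : Integrable (fun x => c ^ 2 * (G x) ^ 2) μ := hIGG.const_mul (c ^ 2)
    have hIs : Integrable (fun x => 3 * ((partialP b J x) ^ 2 + c ^ 2 * (partialQ b J x) ^ 2 + c ^ 2 * (G x) ^ 2)) μ :=
      (hI12.add hI3).const_mul 3
    have h : ∫ x, (F x) ^ 2 ∂μ ≤ ∫ x, 3 * ((partialP b J x) ^ 2 + c ^ 2 * (partialQ b J x) ^ 2 + c ^ 2 * (G x) ^ 2) ∂μ :=
      integral_mono hIFF hIs fun x => by
        show (F x) ^ 2 ≤ 3 * ((partialP b J x) ^ 2 + c ^ 2 * (partialQ b J x) ^ 2 + c ^ 2 * (G x) ^ 2)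
        simp only [hF]
        linarith [sq_nonneg (partialP b J x + c * partialQ b J x), sq_nonneg (partialP b J x - c * G x),
          sq_nonneg (c * partialQ b J x + c * G x)]
    rw [integral_const_mul, integral_add hI12 hI3, integral_add hIpJ (hIqJ.const_mul _), integral_const_mul,
      integral_const_mul] at h
    exact h
  -- (5) arithmetic on real atoms
  have hA0 : 0 ≤ ∫ x, u x * J x ∂μ := by
    have : 0 ≤ κ * T * ∫ x, (v x) ^ 2 ∂μ := mul_nonneg (mul_nonneg hκ0.le hT.le) (integral_nonneg fun x => sq_nonneg _)
    linarith
  generalize hXdef : ∫ x, (v x) ^ 2 ∂μ = X at htap hsplit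
  generalize hWdef : ∫ x, (w x) ^ 2 ∂μ = W at hRC hsplit
  generalize hΦdef : ∫ x, (F x) ^ 2 ∂μ = Φ at hRC hFle
  generalize hAdef : ∫ x, u x * J x ∂μ = A at htap hA0
  generalize hPJdef : ∫ x, (partialP b J x) ^ 2 ∂μ = PJ at hFle
  generalize hQJdef : ∫ x, (partialQ b J x) ^ 2 ∂μ = QJ at hFle
  generalize hGGdef : ∫ x, (G x) ^ 2 ∂μ = GG at hFle
  generalize hQQdef : ∫ x, (partialQ b u x) ^ 2 ∂μ = QQ at hsplit
  have hPJ0 : 0 ≤ PJ := by rw [← hPJdef]; exact integral_nonneg fun x => sq_nonneg _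
  have hQJ0 : 0 ≤ QJ := by rw [← hQJdef]; exact integral_nonneg fun x => sq_nonneg _
  have hGG0 : 0 ≤ GG := by rw [← hGGdef]; exact integral_nonneg fun x => sq_nonneg _
  have hX0 : 0 ≤ X := by rw [← hXdef]; exact integral_nonneg fun x => sq_nonneg _
  -- `2κ² X ≤ 2κ A / T ≤ 4γ A / T`
  have h1 : 2 * κ ^ 2 * X ≤ 4 * γ / T * A := by
    have h1a : κ ^ 2 * X ≤ κ * A / T := by
      rw [le_div_iff₀ hT]
      nlinarith [htap, hκ0.le]
    have h1b : κ * A / T ≤ 2 * γ * A / T :=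
      div_le_div_of_nonneg_right (mul_le_mul_of_nonneg_right hκ2 hA0) hT.le
    have e : 4 * γ / T * A = 2 * (2 * γ * A / T) := by ring
    linarith
  -- `2κ² W ≤ 2Φ ≤ 6 (PJ + (QJ + GG)/γ²)`
  have hc2 : c ^ 2 ≤ 1 / γ ^ 2 := by
    rw [hc, inv_pow, ← one_div]
    exact one_div_le_one_div_of_le (by positivity) (pow_le_pow_left₀ hγ.le hγκ 2)
  have h4 : PJ + c ^ 2 * QJ + c ^ 2 * GG ≤ PJ + (QJ + GG) / γ ^ 2 := by
    have := mul_le_mul_of_nonneg_right hc2 (add_nonneg hQJ0 hGG0)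
    have e : 1 / γ ^ 2 * (QJ + GG) = (QJ + GG) / γ ^ 2 := by ring
    have e' : c ^ 2 * QJ + c ^ 2 * GG = c ^ 2 * (QJ + GG) := by ring
    linarith [this, e, e']
  have h2 : 2 * κ ^ 2 * W ≤ 6 * (PJ + (QJ + GG) / γ ^ 2) := by linarith
  linarith

end Core

/-! ### The position tap budget from (M ∧ D) -/

/-- **The `N`-uniform position tap budget from the two registered stubs** (M) `stub_partialQMem` (fixed-`N`
membership `∂_{q_b}u ∈ L²(μ_T)`) and (D) `stub_hessianDrive` (the Hessian-drive budget), by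
`positionTap_of_hessianDrive_core` and the landed local moments `stub_localMoment`, `stub_localMomentQ`; constant
`C = 4γ/T + 6(C_J⁺ + (C_Q⁺ + C_G⁺)/γ²)`. Together with `mixedTapBound_of_positionTapBudget` (…TapLeakBoundPositionTap):
the position tap budget is EQUIVALENT, over the landed fixed-`N` calculus, to what the pair (M, D) delivers to the
line, and D is not needed for `MixedTapBound` once the position tap budget is known. [folklore] -/
theorem positionTapBudget_of_membership_of_hessianDrive
    (hQU : ∀ ω₂ lam β γ : ℝ, 0 < ω₂ → 0 < lam → 0 < β → 0 < γ → ∀ T : ℝ, 0 < T →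
      ∀ (N : ℕ) (b : Fin N) (u : PhaseSpace N → ℝ), (b.val = 0 ∨ b.val = N - 1) →
        ContDiff ℝ 1 u → MemLp u 2 (gibbsWeight ω₂ lam β γ N T) →
        (∀ᵐ x ∂(gibbsWeight ω₂ lam β γ N T), Tendsto (fun τ : ℝ => ∫ t in Set.Ioc (0 : ℝ) τ,
            (∫ y, (∑ k : Fin N, (pinnedChain ω₂ lam β γ).bondCurrent N k y)
              ∂((pinnedChain ω₂ lam β γ).transitionKernel N T T t.toNNReal x))) atTop (𝓝 (u x))) →
          MemLp (partialQ b u) 2 (gibbsWeight ω₂ lam β γ N T))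
    (hGD : ∀ ω₂ lam β γ : ℝ, 0 < ω₂ → 0 < lam → 0 < β → 0 < γ → ∀ T : ℝ, 0 < T →
      ∃ C : ℝ, ∀ (N : ℕ) (b : Fin N) (u : PhaseSpace N → ℝ), (b.val = 0 ∨ b.val = N - 1) →
        ContDiff ℝ 1 u → MemLp u 2 (gibbsWeight ω₂ lam β γ N T) →
        (∀ᵐ x ∂(gibbsWeight ω₂ lam β γ N T), Tendsto (fun τ : ℝ => ∫ t in Set.Ioc (0 : ℝ) τ,
            (∫ y, (∑ k : Fin N, (pinnedChain ω₂ lam β γ).bondCurrent N k y)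
              ∂((pinnedChain ω₂ lam β γ).transitionKernel N T T t.toNNReal x))) atTop (𝓝 (u x))) →
          MemLp (fun x : PhaseSpace N => ∑ i : Fin N,
            partialQ b (partialQ i ((pinnedChain ω₂ lam β γ).hamiltonian N)) x * partialP i u x) 2
            (gibbsWeight ω₂ lam β γ N T) ∧
          ∫ x, (∑ i : Fin N, partialQ b (partialQ i ((pinnedChain ω₂ lam β γ).hamiltonian N)) x *
              partialP i u x) ^ 2 ∂(gibbsWeight ω₂ lam β γ N T) ≤
            C * (|∫ x, u x * (∑ k : Fin N, (pinnedChain ω₂ lam β γ).bondCurrent N k x) ∂(gibbsWeight ω₂ lam β γ N T)| +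
              ∫ x, Real.exp (-((pinnedChain ω₂ lam β γ).hamiltonian N x) / T) ∂volume)) :
    ∀ ω₂ lam β γ : ℝ, 0 < ω₂ → 0 < lam → 0 < β → 0 < γ → ∀ T : ℝ, 0 < T →
      ∃ C : ℝ, ∀ (N : ℕ) (b : Fin N) (u : PhaseSpace N → ℝ), (b.val = 0 ∨ b.val = N - 1) →
        ContDiff ℝ 1 u → MemLp u 2 (gibbsWeight ω₂ lam β γ N T) →
        (∀ᵐ x ∂(gibbsWeight ω₂ lam β γ N T), Tendsto (fun τ : ℝ => ∫ t in Set.Ioc (0 : ℝ) τ,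
            (∫ y, (∑ k : Fin N, (pinnedChain ω₂ lam β γ).bondCurrent N k y)
              ∂((pinnedChain ω₂ lam β γ).transitionKernel N T T t.toNNReal x))) atTop (𝓝 (u x))) →
          MemLp (partialQ b u) 2 (gibbsWeight ω₂ lam β γ N T) ∧
          ∫ x, (partialQ b u x) ^ 2 ∂(gibbsWeight ω₂ lam β γ N T) ≤
            C * (|∫ x, u x * (∑ k : Fin N, (pinnedChain ω₂ lam β γ).bondCurrent N k x) ∂(gibbsWeight ω₂ lam β γ N T)| +
              ∫ x, Real.exp (-((pinnedChain ω₂ lam β γ).hamiltonian N x) / T) ∂volume) := by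
  intro ω₂ lam β γ hω hl hβ hγ T hT
  obtain ⟨CJ, hCJ⟩ := stub_localMoment ω₂ lam β γ hω hl.le hβ.le T hT
  obtain ⟨CQ, hCQ⟩ := stub_localMomentQ ω₂ lam β γ hω hl.le hβ.le T hT
  obtain ⟨CG, hCG⟩ := hGD ω₂ lam β γ hω hl hβ hγ T hT
  refine ⟨4 * γ / T + 6 * (max CJ 0 + (max CQ 0 + max CG 0) / γ ^ 2), fun N b u hb hu1 hu2 hlim => ?_⟩
  obtain ⟨hu, hpde⟩ := stub_correctorSmooth hω hl hβ hγ hT hu1.continuous hlim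
  have hqu2 := hQU ω₂ lam β γ hω hl hβ hγ T hT N b u hb hu1 hu2 hlim
  obtain ⟨hG2, hGle⟩ := hCG N b u hb hu1 hu2 hlim
  obtain ⟨hqJ2, hqJle⟩ := hCQ N b hb
  obtain ⟨-, hpJle⟩ := hCJ N b hb
  refine ⟨hqu2, (positionTap_of_hessianDrive_core hω hl.le hβ.le hγ hT b hb hu hpde hu2 hqu2 hqJ2 hG2).trans ?_⟩
  -- arithmetic on real atoms (adapted from `stub_mixedTapReduction`)
  have hZ0 : 0 ≤ ∫ x, Real.exp (-((pinnedChain ω₂ lam β γ).hamiltonian N x) / T) ∂volume :=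
    integral_nonneg fun x => (Real.exp_pos _).le
  generalize hZ : ∫ x, Real.exp (-((pinnedChain ω₂ lam β γ).hamiltonian N x) / T) ∂volume = Z at hZ0 hGle hqJle hpJle ⊢
  generalize hA : ∫ x, u x * (∑ k : Fin N, (pinnedChain ω₂ lam β γ).bondCurrent N k x) ∂(gibbsWeight ω₂ lam β γ N T) = A
    at hGle ⊢
  generalize hPJ : ∫ x, (partialP b (fun z : PhaseSpace N => ∑ k : Fin N, (pinnedChain ω₂ lam β γ).bondCurrent N k z) x) ^ 2
    ∂(gibbsWeight ω₂ lam β γ N T) = PJ at hpJle ⊢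
  generalize hQJ' : ∫ x, (partialQ b (fun z : PhaseSpace N => ∑ k : Fin N, (pinnedChain ω₂ lam β γ).bondCurrent N k z) x) ^ 2
    ∂(gibbsWeight ω₂ lam β γ N T) = QJ at hqJle ⊢
  generalize hGG : ∫ x, (∑ i : Fin N, partialQ b (partialQ i ((pinnedChain ω₂ lam β γ).hamiltonian N)) x *
    partialP i u x) ^ 2 ∂(gibbsWeight ω₂ lam β γ N T) = GG at hGle ⊢
  have hS0 : 0 ≤ |A| + Z := add_nonneg (abs_nonneg A) hZ0
  have h1 : PJ ≤ max CJ 0 * (|A| + Z) :=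
    hpJle.trans ((mul_le_mul_of_nonneg_right (le_max_left _ _) hZ0).trans
      (mul_le_mul_of_nonneg_left (by linarith [abs_nonneg A]) (le_max_right _ _)))
  have h2 : QJ ≤ max CQ 0 * (|A| + Z) :=
    hqJle.trans ((mul_le_mul_of_nonneg_right (le_max_left _ _) hZ0).trans
      (mul_le_mul_of_nonneg_left (by linarith [abs_nonneg A]) (le_max_right _ _)))
  have h3 : GG ≤ max CG 0 * (|A| + Z) := hGle.trans (mul_le_mul_of_nonneg_right (le_max_left _ _) hS0)
  have h4 : PJ + (QJ + GG) / γ ^ 2 ≤ (max CJ 0 + (max CQ 0 + max CG 0) / γ ^ 2) * (|A| + Z) := by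
    have h23 : (QJ + GG) / γ ^ 2 ≤ (max CQ 0 + max CG 0) * (|A| + Z) / γ ^ 2 :=
      div_le_div_of_nonneg_right (by linarith) (by positivity)
    have e : (max CJ 0 + (max CQ 0 + max CG 0) / γ ^ 2) * (|A| + Z) =
        max CJ 0 * (|A| + Z) + (max CQ 0 + max CG 0) * (|A| + Z) / γ ^ 2 := by ring
    linarith
  have h5 := mul_le_mul_of_nonneg_left h4 (show (0 : ℝ) ≤ 6 by norm_num)
  have h6 : 4 * γ / T * A ≤ 4 * γ / T * (|A| + Z) :=
    mul_le_mul_of_nonneg_left (by linarith [le_abs_self A]) (by positivity)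
  have e7 : (4 * γ / T + 6 * (max CJ 0 + (max CQ 0 + max CG 0) / γ ^ 2)) * (|A| + Z) =
      4 * γ / T * (|A| + Z) + 6 * ((max CJ 0 + (max CQ 0 + max CG 0) / γ ^ 2) * (|A| + Z)) := by ring
  linarith

/-- **Registered documentation stub `stub_positionTapOfMembershipOfHessianDrive` of line `SketchIdeator2`**
(= `positionTapBudget_of_membership_of_hessianDrive` in closed `∀`-form): the v9/v10 stubs M (`stub_partialQMem`) and D
(`stub_hessianDrive`) imply the v11 stub PTB (`stub_positionTapBudget`), so the v11 reshape loses nothing. [folklore] -/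
theorem stub_positionTapOfMembershipOfHessianDrive : (∀ ω₂ lam β γ : ℝ, 0 < ω₂ → 0 < lam → 0 < β → 0 < γ → ∀ T : ℝ, 0 < T → ∀ (N : ℕ) (b : Fin N) (u : PhaseSpace N → ℝ), (b.val = 0 ∨ b.val = N - 1) → ContDiff ℝ 1 u → MemLp u 2 (gibbsWeight ω₂ lam β γ N T) → (∀ᵐ x ∂(gibbsWeight ω₂ lam β γ N T), Tendsto (fun τ : ℝ => ∫ t in Set.Ioc (0 : ℝ) τ, (∫ y, (∑ k : Fin N, (pinnedChain ω₂ lam β γ).bondCurrent N k y) ∂((pinnedChain ω₂ lam β γ).transitionKernel N T T t.toNNReal x))) atTop (𝓝 (u x))) → MemLp (partialQ b u) 2 (gibbsWeight ω₂ lam β γ N T)) → (∀ ω₂ lam β γ : ℝ, 0 < ω₂ → 0 < lam → 0 < β → 0 < γ → ∀ T : ℝ, 0 < T → ∃ C : ℝ, ∀ (N : ℕ) (b : Fin N) (u : PhaseSpace N → ℝ), (b.val = 0 ∨ b.val = N - 1) → ContDiff ℝ 1 u → MemLp u 2 (gibbsWeight ω₂ lam β γ N T) → (∀ᵐ x ∂(gibbsWeight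 ω₂ lam β γ N T), Tendsto (fun τ : ℝ => ∫ t in Set.Ioc (0 : ℝ) τ, (∫ y, (∑ k : Fin N, (pinnedChain ω₂ lam β γ).bondCurrent N k y) ∂((pinnedChain ω₂ lam β γ).transitionKernel N T T t.toNNReal x))) atTop (𝓝 (u x))) → MemLp (fun x : PhaseSpace N => ∑ i : Fin N, partialQ b (partialQ i ((pinnedChain ω₂ lam β γ).hamiltonian N)) x * partialP i u x) 2 (gibbsWeight ω₂ lam β γ N T) ∧ ∫ x, (∑ i : Fin N, partialQ b (partialQ i ((pinnedChain ω₂ lam β γ).hamiltonian N)) x * partialP i u x) ^ 2 ∂(gibbsWeight ω₂ lam β γ N T) ≤ C * (|∫ x, u x * (∑ k : Fin N, (pinnedChain ω₂ lam β γ).bondCurrent N k x) ∂(gibbsWeight ω₂ lam β γ N T)| + ∫ x, Real.exp (-((pinnedChain ω₂ lam β γ).hamiltonian N x) / T) ∂volume)) → ∀ ω₂ lam β γ : ℝ, 0 < ω₂ → 0 < lam → 0 < β → 0 < γ → ∀ T : ℝ, 0 < T → ∃ C : ℝ, ∀ (N : ℕ) (b : Fin N) (u : PhaseSpace N → ℝ),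 (b.val = 0 ∨ b.val = N - 1) → ContDiff ℝ 1 u → MemLp u 2 (gibbsWeight ω₂ lam β γ N T) → (∀ᵐ x ∂(gibbsWeight ω₂ lam β γ N T), Tendsto (fun τ : ℝ => ∫ t in Set.Ioc (0 : ℝ) τ, (∫ y, (∑ k : Fin N, (pinnedChain ω₂ lam β γ).bondCurrent N k y) ∂((pinnedChain ω₂ lam β γ).transitionKernel N T T t.toNNReal x))) atTop (𝓝 (u x))) → MemLp (partialQ b u) 2 (gibbsWeight ω₂ lam β γ N T) ∧ ∫ x, (partialQ b u x) ^ 2 ∂(gibbsWeight ω₂ lam β γ N T) ≤ C * (|∫ x, u x * (∑ k : Fin N, (pinnedChain ω₂ lam β γ).bondCurrent N k x) ∂(gibbsWeight ω₂ lam β γ N T)| + ∫ x, Real.exp (-((pinnedChain ω₂ lam β γ).hamiltonian N x) / T) ∂volume) :=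
  positionTapBudget_of_membership_of_hessianDrive

end Summit.AtomisticToContinuum.FouriersLaw.Theorems.OddSectorIrreversibility.TapLeak

end
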